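import Summits.BirchSwinnertonDyer.Rank1Residual.Additive.TameBranchOfSemistableTwist
import Summits.BirchSwinnertonDyer.Rank1Residual.Additive.TameBranchUnique
import Literature.NumberTheory.EllipticCurves.PAdicLFunctionMinusMultDistributionProofs
import HarnessLib

/-!
# Class N10, defect 2, E3 twist transport at the Λ-level (companion of
# `TameBranchOfSemistableTwist.lean`): the ODD branch (minus symbols of `E♭`, `p ≡ 3 (mod 4)`),
# the JOIN with the typed main conjecture `TameBranchRatCharEqAt`, and `∃!`
# (cell `b2b-bsdres`, lane CLASS-CLOSURE, seat cc-typer-2 GEN 3)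

HONEST FRAMING (cell `b2b-bsdres`, run/shared/lean/b2b/bsd-rank1-residual/, verbatim in every
file): the goal of the cell is to DELETE the COMBINATION-SHAPED residual classes of the
Birch–Swinnerton-Dyer formula for ALL analytic-rank `≤ 1` elliptic curves over `ℚ` — "full BSD
formula for every rank `≤ 1` curve in class `C`" assembled STRICTLY from published theorems — so
that the rank-`≤ 1` remainder becomes exactly the CONSTRUCTION-SHAPED classes, which are TYPED
(missing-input `Prop`s), NOT attempted. This is not "finishing BSD". Lane CLASS-CLOSURE
(coordinator ruling 2026-08-21T04:07Z): research routes, no claim beyond the stated classes;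
census output = EVIDENCE / conjecture items with held-out validation, NEVER a Literature fact;
the class N10 stays CONSTRUCTION-shaped (RESIDUAL-MAP §I); NOTHING is booked. THEOREMS ONLY; no
definition, no named fact, no conjecture node; labels / RESIDUAL-MAP marks UNCHANGED.

## Contents

* §6 ODD branch: for `p* = −p` (`p ≡ 3 (mod 4)`) the Legendre character is odd and the partner
  symbol is `c·[·]⁻_{f♭}` (`LegendreTwistMinusRel`); the minus Hecke relations are the tree's
  `intCast_mul_ratMinusSymbol` / `intCast_mul_ratMinusSymbol_of_dvd` (rationality
  `ratCast_ratMinusSymbol`); the ONE input not in the tree for minus symbols — a common denominator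
  (`hden`, Manin–Drinfeld for `[·]⁻`; plus twin `exists_forall_ratPlusSymbol_eq_div_of_maninDrinfeld`)
  — is an explicit binder. Results `exists_isTameBranchOf_legendreMinus_of_goodOrd/_of_mult`.
* §7 JOIN: `TameBranchRatCharEqAt W p` (typed, NOT in print, nothing asserted) + any defect-2
  tame-branch tuple for the Legendre character (`orderOf χ_p = 2 = tameDefect W p`) ⟹ every Selmer
  dual datum of `E/ℚ_∞` is `Λ`-torsion with characteristic series `p^k·B`; (M) form with the defect
  hypothesis discharged (`tameDefect_of_potMult`).
* §8 `∃!`: by `IsTameBranchOf.unique` the delivered branch is THE branch for `(f, χ_p, α)`.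

References: Mazur–Tate–Teitelbaum, Invent. Math. 84 (1986) §I.4, §I.8, §I.10, §I.14
[MazurTateTeitelbaum1986Invent]; Shimura 1971 Prop. 3.64 [Shimura1971]; Delbourgo 1998 §1.5,
hypothesis (M) p. 133, Main Conjecture p. 151 [Delbourgo1998]; HOME/class-closure/N10/TRANSPORT-TEMPLATE.md R2.
-/

noncomputable section

open scoped Classical MatrixGroups ModularForm

open CongruenceSubgroup

namespace Summit.BirchSwinnertonDyer.Rank1Residual.Additive

open Literature.NumberTheory.EllipticCurves Literature.NumberTheory.EllipticCurves.ModularForms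
  Literature.NumberTheory.EllipticCurves.Rank1Residual WeierstrassCurve

/-! ### §6 Odd branch (`p ≡ 3 (mod 4)`): the MINUS symbols of the twist curve -/

section Minus

variable {p : ℕ} [hp : Fact p.Prime] {N N' : ℕ} [NeZero N'] {f : CuspForm (Gamma0 N) 2}
  {g : CuspForm (Gamma0 N') 2}

/-- **Odd branch, good ordinary twist: the tame branch for `α = unitRoot E♭ p` from the MINUS
symbols of `g = f_{E♭}`.** As `exists_isTameBranchOf_legendre_of_goodOrd` with
`LegendreTwistMinusRel` (the partner symbol is `c·[·]⁻_g`): the minus Hecke relation is the tree's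
`intCast_mul_ratMinusSymbol` (rationality `ratCast_ratMinusSymbol`); the one input NOT yet in the
tree for minus symbols is the common denominator (`hden`: Manin–Drinfeld for `[·]⁻_g`; the plus
twin is `exists_forall_ratPlusSymbol_eq_div_of_maninDrinfeld`) — an explicit binder here.
[cite: MazurTateTeitelbaum1986Invent, §I.4 (4.2), §I.8 and §I.10 (10.1)–(10.2)] -/
theorem exists_isTameBranchOf_legendreMinus_of_goodOrd (V : WeierstrassCurve ℚ) [V.IsElliptic]
    [V.IsGloballyMinimal] (hp2 : p ≠ 2) (hord : IsOrdinaryAt V p) (hg : IsNewformOf V g)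
    {D : ℕ} (hD : 0 < D) (hden : ∀ r : ℚ, ∃ m : ℤ, ratMinusSymbol g r = (m : ℚ) / D)
    {c : ℚ} (hrel : LegendreTwistMinusRel p f g c) :
    ∃ B : PowerSeries ℚ_[p],
      IsTameBranchOf f p ((legendreChar p).ringHomComp (algebraMap ℚ_[p] ℂ_[p]))
        (unitRoot V p : ℚ_[p]) B ∧
      ∀ C : ℝ, (∀ r : ℚ, ‖((ratPlusSymbol f r : ℚ) : ℚ_[p])‖ ≤ C) →
        ∀ n : ℕ, ‖PowerSeries.coeff n B‖ ≤ C := by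
  haveI : NeZero p := ⟨hp.out.ne_zero⟩
  have hrat := ratCast_ratMinusSymbol g hg.1 (IsNewformOf.coeffField_eq_bot hg)
  obtain ⟨c', hlat⟩ := exists_forall_eq_mul_padicInt_of_eq_div (p := p) hD hden c
  obtain ⟨hαeq, hαu, -⟩ := unitRoot_coe_spec (W := V) hord
  have hpN : ¬ p ∣ N' := not_dvd_level_of_isNewformOf hg hord.1
  have hap := cuspCoeff_eq_frobeniusTrace_of_isNewformOf_holds hg hord.1
  refine exists_isTameBranchOf_of_heckeSymbol (S := fun r ↦ (c : ℚ_[p]) * ((ratMinusSymbol g r : ℚ) : ℚ_[p]))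
    (ap := ((V.frobeniusTrace p : ℤ) : ℚ_[p])) (δ := 1) (c := c')
    (legendreChar_ne_one p hp2) (fun s ↦ ?_) hrel.cast_eq_twist (fun r ↦ ?_) ?_ hαu
    (by rw [norm_one]) hlat
  · rw [show (s + 1 : ℚ) = s + ((1 : ℤ) : ℚ) by push_cast; rfl, ratMinusSymbol_add_intCast]
  · have h := intCast_mul_ratMinusSymbol p hg.1 hp.out hpN hap hrat r
    have h' := congrArg (fun q : ℚ ↦ (c : ℚ_[p]) * (q : ℚ_[p])) h
    push_cast at h'
    rw [mul_add, Finset.mul_sum] at h'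
    linear_combination h'
  · rw [one_mul]; exact hαeq

/-- **Odd branch, multiplicative twist: the tame branch for `α = a_p(E♭) = ±1` from the MINUS
symbols** (`U_p` relation `intCast_mul_ratMinusSymbol_of_dvd`; denominator binder `hden` as above).
[cite: MazurTateTeitelbaum1986Invent, §I.10 (10.1) with ε(p) = 0] -/
theorem exists_isTameBranchOf_legendreMinus_of_mult (hp2 : p ≠ 2) (hg : IsNewform0 g)
    (hQ : coeffField g = ⊥) (hpN : p ∣ N') {ap : ℤ} (hap : cuspCoeff g p = ap)
    (hap1 : ap = 1 ∨ ap = -1) {D : ℕ} (hD : 0 < D)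
    (hden : ∀ r : ℚ, ∃ m : ℤ, ratMinusSymbol g r = (m : ℚ) / D)
    {c : ℚ} (hrel : LegendreTwistMinusRel p f g c) :
    ∃ B : PowerSeries ℚ_[p],
      IsTameBranchOf f p ((legendreChar p).ringHomComp (algebraMap ℚ_[p] ℂ_[p]))
        ((ap : ℤ) : ℚ_[p]) B ∧
      ∀ C : ℝ, (∀ r : ℚ, ‖((ratPlusSymbol f r : ℚ) : ℚ_[p])‖ ≤ C) →
        ∀ n : ℕ, ‖PowerSeries.coeff n B‖ ≤ C := by
  haveI : NeZero p := ⟨hp.out.ne_zero⟩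
  have hrat := ratCast_ratMinusSymbol g hg hQ
  obtain ⟨c', hlat⟩ := exists_forall_eq_mul_padicInt_of_eq_div (p := p) hD hden c
  have hαu : ‖((ap : ℤ) : ℚ_[p])‖ = 1 := by
    rcases hap1 with h | h <;> simp [h]
  refine exists_isTameBranchOf_of_heckeSymbol (S := fun r ↦ (c : ℚ_[p]) * ((ratMinusSymbol g r : ℚ) : ℚ_[p]))
    (ap := ((ap : ℤ) : ℚ_[p])) (δ := 0) (c := c')
    (legendreChar_ne_one p hp2) (fun s ↦ ?_) hrel.cast_eq_twist (fun r ↦ ?_) (by ring) hαu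
    (by rw [norm_zero]; exact zero_le_one) hlat
  · rw [show (s + 1 : ℚ) = s + ((1 : ℤ) : ℚ) by push_cast; rfl, ratMinusSymbol_add_intCast]
  · have h := intCast_mul_ratMinusSymbol_of_dvd p hg hp.out hpN hap hrat r
    have h' := congrArg (fun q : ℚ ↦ (c : ℚ_[p]) * (q : ℚ_[p])) h
    push_cast at h'
    rw [Finset.mul_sum] at h'
    linear_combination h'

end Minus

/-! ### §7 JOIN with the typed main conjecture on defect 2 -/

section Join

variable (W : WeierstrassCurve ℚ) [W.IsElliptic] [W.IsGloballyMinimal] (p : ℕ) [hp : Fact p.Prime]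

/-- **JOIN (N10 defect-2 rows ← the twist curve's classical theory).** For the globally minimal
additive curve `E = W` at the odd prime `p` on the (M) or (G-ord) locus with tame defect `2`
(`tameDefect W p = 2`: Kodaira `I_n*` / `I₀*`), its newform `f`, and ANY tame-branch tuple for the
Legendre character with a unit `α` and a witness `B` — in particular the one DELIVERED by §4–§6 from
the twist curve `E♭` (`α = unitRoot E♭ p` / `a_p(E♭)`) modulo the Legendre twist relation —, the
typed RATIONAL tame-branch main conjecture `TameBranchRatCharEqAt W p` (`TameBranchLower.lean`; NOT
in print, nothing asserted) INSTANTIATES: every Selmer dual datum of `E` over `ℚ_∞` is `Λ`-torsion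
with characteristic power series `p^k·B`. Both inputs are explicit binders; nothing booked. -/
theorem isTorsion_and_charIdeal_eq_of_tameBranchRatCharEq_legendre (hT : TameBranchRatCharEqAt W p)
    (hp2 : p ≠ 2) (hadd : Addv W p) (hloc : PotMult W p ∨ TypeGOrd W p) (he : tameDefect W p = 2)
    {K : ZpExtension ℚ p} {γ : Field.absoluteGaloisGroup ℚ} (hK : K.IsCyclotomic)
    (hγ : K.IsTopGenerator γ) (hcyc : IsCyclotomicVariable p γ)
    {N : ℕ} [NeZero N] {f : CuspForm (Gamma0 N) 2} (hf : IsNewformOf W f)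
    {α : ℚ_[p]} (hαu : ‖α‖ = 1) {B : PowerSeries ℚ_[p]}
    (hB : IsTameBranchOf f p ((legendreChar p).ringHomComp (algebraMap ℚ_[p] ℂ_[p])) α B)
    (D : W.SelmerDualData K γ) :
    D.IsTorsion ∧ ∃ (g : IwasawaAlgebra p) (k : ℤ), D.charIdeal = Ideal.span {g} ∧
      iwasawaToPowerSeries p g = PowerSeries.C ((p : ℚ_[p]) ^ k) * B :=
  hT _ α B hp2 hadd hloc hK hγ hcyc hf (by rw [orderOf_legendreChar_ringHomComp p hp2, he]) hαu hB D

/-- **The (M) locus has tame defect `2`** (bookkeeping for the join: `PotMult W p → tameDefect W p = 2`,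
`tameDefect_of_potMult`), so on (M) rows the join needs no defect hypothesis. [folklore] -/
theorem isTorsion_and_charIdeal_eq_of_tameBranchRatCharEq_legendre_of_potMult
    (hT : TameBranchRatCharEqAt W p) (hp2 : p ≠ 2) (hadd : Addv W p) (hM : PotMult W p)
    {K : ZpExtension ℚ p} {γ : Field.absoluteGaloisGroup ℚ} (hK : K.IsCyclotomic)
    (hγ : K.IsTopGenerator γ) (hcyc : IsCyclotomicVariable p γ)
    {N : ℕ} [NeZero N] {f : CuspForm (Gamma0 N) 2} (hf : IsNewformOf W f)
    {α : ℚ_[p]} (hαu : ‖α‖ = 1) {B : PowerSeries ℚ_[p]}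
    (hB : IsTameBranchOf f p ((legendreChar p).ringHomComp (algebraMap ℚ_[p] ℂ_[p])) α B)
    (D : W.SelmerDualData K γ) :
    D.IsTorsion ∧ ∃ (g : IwasawaAlgebra p) (k : ℤ), D.charIdeal = Ideal.span {g} ∧
      iwasawaToPowerSeries p g = PowerSeries.C ((p : ℚ_[p]) ^ k) * B :=
  isTorsion_and_charIdeal_eq_of_tameBranchRatCharEq_legendre W p hT hp2 hadd (Or.inl hM)
    (tameDefect_of_potMult W p hM) hK hγ hcyc hf hαu hB D

end Join

/-! ### §8 Uniqueness: on defect 2 the delivered tame branch is THE tame branch for `(f, χ_p, α)` -/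

section Unique

variable {p : ℕ} [hp : Fact p.Prime] {N N' : ℕ} [NeZero N'] {f : CuspForm (Gamma0 N) 2}
  {g : CuspForm (Gamma0 N') 2}

/-- **(G-ord, `e = 2`): `∃!`.** The E-normalised tame branch for `(f, χ_p, unitRoot E♭ p)` delivered
by `exists_isTameBranchOf_legendre_of_goodOrd` is the ONLY bounded witness for that tuple
(`IsTameBranchOf.unique`, `TameBranchUnique.lean`): its coefficients, the unit-coefficient
certificate and integrality are invariants of `(E, p)` given the Legendre twist relation.
[cite: MazurTateTeitelbaum1986Invent, §I.11 and §I.14 (14.3)] -/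
theorem existsUnique_isTameBranchOf_legendre_of_goodOrd (V : WeierstrassCurve ℚ) [V.IsElliptic]
    [V.IsGloballyMinimal] (hp2 : p ≠ 2) (hord : IsOrdinaryAt V p) (hg : IsNewformOf V g) {c : ℚ}
    (hrel : LegendreTwistPlusRel p f g c) :
    ∃! B : PowerSeries ℚ_[p],
      IsTameBranchOf f p ((legendreChar p).ringHomComp (algebraMap ℚ_[p] ℂ_[p]))
        (unitRoot V p : ℚ_[p]) B := by
  obtain ⟨B, hB, -⟩ := exists_isTameBranchOf_legendre_of_goodOrd V hp2 hord hg hrel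
  exact ⟨B, hB, fun B' hB' ↦ hB'.unique hB⟩

/-- **(M): `∃!`.** The tame branch for `(f, χ_p, a_p(E♭))` delivered by
`exists_isTameBranchOf_legendre_of_mult` is the only bounded witness for that tuple.
[cite: MazurTateTeitelbaum1986Invent, §I.11 and §I.14 (14.3)] -/
theorem existsUnique_isTameBranchOf_legendre_of_mult (hp2 : p ≠ 2) (hg : IsNewform0 g)
    (hQ : coeffField g = ⊥) (hpN : p ∣ N') {ap : ℤ} (hap : cuspCoeff g p = ap)
    (hap1 : ap = 1 ∨ ap = -1) {c : ℚ} (hrel : LegendreTwistPlusRel p f g c) :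
    ∃! B : PowerSeries ℚ_[p],
      IsTameBranchOf f p ((legendreChar p).ringHomComp (algebraMap ℚ_[p] ℂ_[p]))
        ((ap : ℤ) : ℚ_[p]) B := by
  obtain ⟨B, hB, -⟩ := exists_isTameBranchOf_legendre_of_mult hp2 hg hQ hpN hap hap1 hrel
  exact ⟨B, hB, fun B' hB' ↦ hB'.unique hB⟩

end Unique

end Summit.BirchSwinnertonDyer.Rank1Residual.Additive

end
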